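import Literature.Geometry.Kaehler.ComplexTorusAndreHodgeMetric
import Literature.Geometry.Kaehler.ComplexTorusLefschetzOperatorsReal
import Mathlib.Analysis.InnerProductSpace.Trace
import HarnessLib

/-!
# André's transposition `u ↦ u′ := *_H ᵗu *_H` is the ADJUNCTION of the Hodge metric `⟨ , ⟩_H` on real operators commuting with the Weil operator,
# hence `Tr(u ∘ *_H ᵗu *_H) > 0` for every such `u ≠ 0` — André 1996 Prop. 3.3 / Kleiman 1968 Thm. 3.11 on a complex torus, unconditionally

Layer `Literature/Geometry/Kaehler`, namespace `Literature.Geometry.Kaehler.ComplexTorus`; lane `lit-hodgefound` (Track 2 foundations library),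
prover seat `lit-hodgefound-p35` (generation 52, row g52-#2; sequel of row g52-#1 `ComplexTorusAndreHodgeMetric` (the positive definite Hermitian form
`⟨x, y⟩_H = sign_X(e)(−1)^g K_H(C y, x̄)` on `H•(X; ℂ) = GForm E ℂ` and its `InnerProductSpace.Core`), of rows g51-#1/#5 (`poincarePairingG`, `K_H`,
`isAdjointPair_compl₂_andreHodgeInvolution_of_isAdjointPair`: `*_H ᵗu *_H` is the `K_H`-transpose of `u`) and of p09's `ComplexTorusLefschetzOperatorsReal`
(`conjG_weylOperator`: the Weyl operator is real)). THEOREMS ONLY (no definition, no named fact, no instance, no notation; D-0026 net debt `0`).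

THE POINT (André 1996, Prop. 3.3, read on the page: "la forme bilinéaire symétrique sur `C⁰_mot(X, X)` donnée par `(u, v) ↦ Tr_{H(X)}(u *_H ᵗv *_H)` est à valeurs
dans `ℚ`, et définie positive", proof: "Le théorème de l'indice de Hodge entraîne que `(x, y) ↦ ∫ x ∪ *_H y` définit un produit scalaire […] cf. [Kl68], 3.11").
On a complex torus the Hodge index theorem / Hodge–Riemann relations are theorems of the tree, and row g52-#1 turned them into the Hodge METRIC `⟨ , ⟩_H`. For an
operator `u` on `H•(X; ℂ)` which is REAL (`u x̄ = \overline{u x}`) and commutes with the Weil operator `C` (e.g. any endomorphism of the real Hodge structure, in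
particular the action of an algebraic correspondence), with Poincaré transpose `ᵗu` (`B_e(u x, y) = B_e(x, ᵗu y)`), ANDRÉ'S ADJOINT `u′ := *_H ᵗu *_H` satisfies
`⟨u′ x, y⟩_H = ⟨x, u y⟩_H` (§3): it IS the adjoint of `u` for the inner product `⟨ , ⟩_H`. Consequently `Tr(u ∘ u′) = Σᵢ ‖u′ bᵢ‖²_H ≥ 0` in an `⟨ , ⟩_H`-orthonormal basis,
with equality iff `u = 0` (§4) — the positivity of André's Prop. 3.3 / Kleiman's Thm. 3.11 ("`u ↦ u'` is a positive involution"), here for ALL real `C`-commuting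
operators of the torus, not only algebraic ones, and with no standard conjecture assumed.

## What is proved (`X = E/Φ(ℤ^ι)`, `η` non-degenerate (`hη`), `B = poincarePairingG Φ e`, `*_H = (hasLefschetzProperty_lefschetzG hη).andreHodgeInvolution isZGrading_countingG
(finrank ℂ E)`, `K_H = B.compl₂ *_H`, `C = rotG E (π/2)`, `x̄ = conjG x`; in §4 `η` is a Kähler datum (`h11`, `hpos`, `hη`) and `e : Fin (2g) ≃ ι`)

* §1 REALITY: **`poincarePairing_conjForm_conjForm`** (`⟨x̄, ȳ⟩_e = conj ⟨x, y⟩_e`), **`poincarePairingG_conjG_conjG`** (`B(w̄, w̄') = conj B(w, w')`), **`conjG_andreHodgeInvolution`**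
  (`\overline{*_H w} = *_H w̄`: `*_H = ±w` degreewise with the REAL Weyl operator), `compl₂_andreHodgeInvolution_conjG_conjG` (`K_H(w̄, w̄') = conj K_H(w, w')`), `conjG_rotG`
  (`\overline{(e^{iθ})^* w} = (e^{iθ})^* w̄`), **`conjG_apply_of_isAdjointPair_poincarePairingG`** (the Poincaré transpose of a real operator is real).
* §2 **`commute_pullAlgHom_andreHodgeInvolution`** (`M^*` commutes with `*_H` for every `η`-preserving `M`: `*_H ∈ ℂ[L_η, ᶜΛ_η]` and p34's bicommutant criterion),
  **`commute_rotG_andreHodgeInvolution`** (`(e^{iθ})^*`, in particular `C`, commutes with `*_H` for `η` of type `(1,1)`), `rotG_andreHodgeInvolution_apply`.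
* §3 THE ADJUNCTION: **`andreHodgeMetric_andreAdjoint_left`** (`⟨(*_H ᵗu *_H) x, y⟩_H = ⟨x, u y⟩_H` for `u` real commuting with `C`), `andreHodgeMetric_andreAdjoint_right`
  (`⟨x, (*_H ᵗu *_H) y⟩_H = ⟨u x, y⟩_H`, Kähler datum).
* §4 POSITIVITY OF THE TRACE: `exists_nonneg_trace_mul_andreAdjoint` (`Tr(u ∘ *_H ᵗu *_H) = c ≥ 0`, and `c > 0` if `u ≠ 0`), **`exists_pos_trace_mul_andreAdjoint`**
  (`Tr(u ∘ *_H ᵗu *_H) > 0` for `u ≠ 0`), **`trace_mul_andreAdjoint_eq_zero_iff`** (`= 0 ↔ u = 0`), `exists_pos_trace_andreAdjoint_mul` (`Tr(*_H ᵗu *_H ∘ u) > 0`),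
  `IsRiemannForm.exists_pos_trace_mul_andreAdjoint`.

## Sources, VERBATIM

* Y. André, *Pour une théorie inconditionnelle des motifs*, Publ. Math. IHÉS **83** (1996) [Andre1996Motifs], held `paper:doi-10-1007-bf02698643`: Prop. 3.3 (p. 21 = chunk
  p0018 L33–L38): "Supposons que `K` soit de caractéristique nulle et que `H•` soit une cohomologie classique […] La `ℚ`-algèbre `C⁰_mot(X, X)` est semi-simple de dimension
  finie. De plus, la forme bilinéaire symétrique sur `C⁰_mot(X, X)` donnée par `(u, v) ↦ Tr_{H(X)}(u *_H ᵗv *_H)` est à valeurs dans `ℚ`, et définie positive."; proof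
  (p. 22 = chunk p0019 L1–L6): "Le théorème de l'indice de Hodge entraîne que `(x, y) ↦ ∫ x ∪ *_H y` définit un produit scalaire sur les cycles motivés (car ceux-ci sont
  clairement de type `(p,p)`) […] La dernière assertion résulte aussi du théorème de l'indice de Hodge, cf. [Kl68], 3.11."; §1.1 (p. 11 = chunk p0008 L12–L14):
  "`L`, `*_L`, `*_H` et `ᶜΛ` sont auto-adjoints relativement à l'accouplement de dualité de Poincaré".
* S. L. Kleiman, *Algebraic cycles and the Weil conjectures*, in Dix exposés sur la cohomologie des schémas (1968) [Kleiman1968AlgebraicCycles], §3 Thm. 3.11 (the map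
  `u ↦ u'` on the algebra of algebraic correspondences is a positive involution: `Tr(u ∘ u') > 0` for `u ≠ 0`, under the Hodge standard conjecture; cited through André).
* J. S. Milne, *Polarizations and Grothendieck's standard conjectures*, Ann. of Math. **155** (2002) [Milne2002Polarizations], held
  `paper:milne2002-polarizations-grothendieck-s-standard-conjectures`, p. 7 (chunk p0007 L13–L15): "the trace pairing `u, v ↦ Tr(u·v†)` of the Rosati involution […]
  which is positive-definite (Weil 1948, Théorème 38)".
* P. Deligne, *Théorie de Hodge II* (1971) [DeligneHodgeII1971], Déf. 2.1.15 (polarisation: "`Ψ(x, Cy)` […] symétrique et définie positive").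
* D. Huybrechts, *Complex Geometry* (2005) [Huybrechts2005], §1.2 Remark 1.2.19 (i) ("`L` is the `ℂ`-linear extension of the real operator"), Exercise 1.2.3
  ("`[L, 𝐈] = [Λ, 𝐈] = 0`").
* R. A. Horn, C. R. Johnson, *Matrix Analysis*, 2nd ed. (CUP 2013) [HornJohnson2013], §5.6 / (0.2.5) (`tr(A*A) = Σ |a_{ij}|² ≥ 0`, `= 0` iff `A = 0` — the Frobenius norm).

## Scope / not here

The rationality "à valeurs dans `ℚ`" of the trace form and its restriction to `′`-stable subalgebras (semisimplicity via Jannsen's argument, André Prop. 3.1) are left to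
the sequel rows; only invariant forms of complex tori; normalisation `d = g` of `*_H`.
-/

noncomputable section

namespace Literature.Geometry.Kaehler

namespace ComplexTorus

open Module Function Finset
open Literature.LinearAlgebra.Alternating Literature.Algebra.Lie Literature.Analysis.Complex

set_option maxSynthPendingDepth 3

universe uE

variable {ι : Type*} [Fintype ι] [DecidableEq ι] {E : Type uE} [NormedAddCommGroup E] [NormedSpace ℂ E] [FiniteDimensional ℂ E]
  [Nontrivial E] (Φ : (ι → ℝ) ≃L[ℝ] E) {η : E [⋀^Fin 2]→L[ℝ] ℝ} (hη : ∀ v : E, v ≠ 0 → ∃ w : E, η ![v, w] ≠ 0) {N : ℕ}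

/-! ## §0 Toolkit: `Tr(T ∘ T*) = Σ ‖T* bᵢ‖² ≥ 0`, `> 0` for `T ≠ 0`, for the adjoint w.r.t. any inner-product core -/

section Toolkit

omit [Fintype ι] [DecidableEq ι] [NormedAddCommGroup E] [NormedSpace ℂ E] [FiniteDimensional ℂ E] [Nontrivial E] in
/-- **`Tr(T ∘ S) = Σᵢ ‖S bᵢ‖² ≥ 0`, positive if `T ≠ 0`, when `S` is the adjoint of `T`** for a positive definite Hermitian form on a finite-dimensional complex space
(`⟨S x, y⟩ = ⟨x, T y⟩`): in an orthonormal basis `Tr(T S) = Σᵢ ⟨bᵢ, T S bᵢ⟩ = Σᵢ ⟨S bᵢ, S bᵢ⟩`, and `S = 0` forces `⟨T y, T y⟩ = ⟨S T y, y⟩ = 0`. (The Frobenius norm.)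
[cite: HornJohnson2013, §5.6 and (0.2.5)] -/
private theorem exists_nonneg_trace_mul_eq₅₅ {V : Type*} [AddCommGroup V] [Module ℂ V] [FiniteDimensional ℂ V] (cV : InnerProductSpace.Core ℂ V)
    {T S : Module.End ℂ V} (hS : ∀ x y, cV.inner (S x) y = cV.inner x (T y)) :
    ∃ r : ℝ, 0 ≤ r ∧ LinearMap.trace ℂ V (T * S) = r ∧ (T ≠ 0 → 0 < r) := by
  letI : InnerProductSpace.Core ℂ V := cV
  letI : NormedAddCommGroup V := @InnerProductSpace.Core.toNormedAddCommGroup ℂ V _ _ _ cV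
  letI : InnerProductSpace ℂ V := InnerProductSpace.ofCore cV.toCore
  have hS' : ∀ x y : V, inner ℂ (S x) y = inner ℂ x (T y) := hS
  let b := stdOrthonormalBasis ℂ V
  have htr : LinearMap.trace ℂ V (T * S) = ∑ i, inner ℂ (S (b i)) (S (b i)) := by
    rw [LinearMap.trace_eq_sum_inner (T * S) b]
    exact Finset.sum_congr rfl fun i _ ↦ (hS' (b i) (S (b i))).symm
  refine ⟨∑ i, ‖S (b i)‖ ^ 2, Finset.sum_nonneg fun i _ ↦ sq_nonneg _, ?_, fun hT ↦ ?_⟩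
  · rw [htr, Complex.ofReal_sum]
    exact Finset.sum_congr rfl fun i _ ↦ by rw [inner_self_eq_norm_sq_to_K, RCLike.ofReal_eq_complex_ofReal, Complex.ofReal_pow]
  · by_contra hle
    push Not at hle
    have hsum : ∑ i, ‖S (b i)‖ ^ 2 = 0 := le_antisymm hle (Finset.sum_nonneg fun i _ ↦ sq_nonneg _)
    have hzero : ∀ i, S (b i) = 0 := fun i ↦ by
      have hi := (Finset.sum_eq_zero_iff_of_nonneg fun j _ ↦ sq_nonneg ‖S (b j)‖).1 hsum i (Finset.mem_univ i)
      exact norm_eq_zero.1 ((pow_eq_zero_iff two_ne_zero).1 hi)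
    have hS0 : S = 0 := b.toBasis.ext fun i ↦ by rw [OrthonormalBasis.coe_toBasis, hzero, LinearMap.zero_apply]
    refine hT (LinearMap.ext fun y ↦ ?_)
    have h := hS' (T y) y
    rw [hS0, LinearMap.zero_apply, inner_zero_left] at h
    rw [LinearMap.zero_apply]
    exact inner_self_eq_zero.1 h.symm

end Toolkit

/-! ## §1 Reality of the Poincaré pairing, of `*_H`, of `K_H`, of `C` and of Poincaré transposes -/

section Reality

omit [Fintype ι] [FiniteDimensional ℂ E] [Nontrivial E] in
/-- **`⟨x̄, ȳ⟩_e = \overline{⟨x, y⟩_e}`**: the cup-product pairing of the torus is REAL (the wedge of conjugates is the conjugate of the wedge, and the evaluation on the real lattice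
frame commutes with conjugation). [cite: Huybrechts2005, §1.2 Remark 1.2.19 (i)] [cite: Andre1996Motifs, §1.1 (p. 11)] -/
theorem poincarePairing_conjForm_conjForm (e : Fin N ≃ ι) {k l : ℕ} (h : k + l = N) (x : E [⋀^Fin k]→L[ℝ] ℂ) (y : E [⋀^Fin l]→L[ℝ] ℂ) :
    poincarePairing Φ e h (conjForm x) (conjForm y) = starRingEnd ℂ (poincarePairing Φ e h x y) := by
  rw [poincarePairing_apply, poincarePairing_apply, ← conj_wedge, conjForm_apply]

omit [Fintype ι] [FiniteDimensional ℂ E] [Nontrivial E] in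
/-- **`B_e(w̄, w̄') = \overline{B_e(w, w')}`**: the graded Poincaré pairing on `H•(X; ℂ)` is real. [cite: Andre1996Motifs, §1.1 (p. 11)] [cite: Huybrechts2005, §1.2 Remark 1.2.19 (i)] -/
theorem poincarePairingG_conjG_conjG (e : Fin N ≃ ι) (w w' : GForm E ℂ) :
    poincarePairingG Φ e (GForm.conjG w) (GForm.conjG w') = starRingEnd ℂ (poincarePairingG Φ e w w') := by
  rw [poincarePairingG_apply, poincarePairingG_apply, map_sum]
  exact Finset.sum_congr rfl fun k _ ↦ by rw [GForm.conjG_apply, GForm.conjG_apply, poincarePairing_conjForm_conjForm]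

omit [Fintype ι] [DecidableEq ι] in
/-- **`\overline{*_H w} = *_H w̄`: André's Hodge involution is REAL** (normalisation `d = g`): on `Hⁿ(X; ℂ)` it is `(−1)^{g + n(n−1)/2} · w` (row g49-#3) with the Weyl operator `w`
real (p09's `conjG_weylOperator`) and a real sign. [cite: Andre1996Motifs, §1.1 (p. 10, definition of *_H)] [cite: Huybrechts2005, §1.2 Remark 1.2.19 (i)] -/
theorem conjG_andreHodgeInvolution (hη : ∀ v : E, v ≠ 0 → ∃ w : E, η ![v, w] ≠ 0) (w : GForm E ℂ) :
    GForm.conjG ((hasLefschetzProperty_lefschetzG hη).andreHodgeInvolution isZGrading_countingG (finrank ℂ E) w) =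
      (hasLefschetzProperty_lefschetzG hη).andreHodgeInvolution isZGrading_countingG (finrank ℂ E) (GForm.conjG w) := by
  have key : ∀ (n : ℕ) (x : E [⋀^Fin n]→L[ℝ] ℂ),
      GForm.conjG ((hasLefschetzProperty_lefschetzG hη).andreHodgeInvolution isZGrading_countingG (finrank ℂ E) (GForm.of n x)) =
        (hasLefschetzProperty_lefschetzG hη).andreHodgeInvolution isZGrading_countingG (finrank ℂ E) (GForm.conjG (GForm.of n x)) := fun n x ↦ by
    rw [GForm.conjG_of, andreHodgeInvolution_of hη rfl n x, andreHodgeInvolution_of hη rfl n (conjForm x), GForm.conjG_smul, map_pow, map_neg, map_one,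
      conjG_weylOperator hη, GForm.conjG_of]
  conv_lhs => rw [← sum_range_of_eq w]
  conv_rhs => rw [← sum_range_of_eq w]
  rw [map_sum, GForm.conjG_sum, GForm.conjG_sum, map_sum]
  exact Finset.sum_congr rfl fun n _ ↦ key n (w n)

omit [Fintype ι] in
/-- **`K_H(w̄, w̄') = \overline{K_H(w, w')}`**: André's form `K_H = B_e(·, *_H ·)` is real. [cite: Andre1996Motifs, §1.1 (p. 11), Prop. 3.3 (proof, p. 22)] -/
theorem compl₂_andreHodgeInvolution_conjG_conjG (e : Fin N ≃ ι) (w w' : GForm E ℂ) :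
    (poincarePairingG Φ e).compl₂ ((hasLefschetzProperty_lefschetzG hη).andreHodgeInvolution isZGrading_countingG (finrank ℂ E)) (GForm.conjG w) (GForm.conjG w') =
      starRingEnd ℂ ((poincarePairingG Φ e).compl₂ ((hasLefschetzProperty_lefschetzG hη).andreHodgeInvolution isZGrading_countingG (finrank ℂ E)) w w') := by
  rw [LinearMap.compl₂_apply, LinearMap.compl₂_apply, ← conjG_andreHodgeInvolution hη, poincarePairingG_conjG_conjG]

omit [FiniteDimensional ℂ E] [Nontrivial E] in
/-- **`\overline{(e^{iθ})^* w} = (e^{iθ})^* w̄`**: the Hodge circle action, in particular the Weil operator `C = (e^{iπ/2})^*`, is real (a pull-back along a real-linear map).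
[cite: Huybrechts2005, §1.2 (p. 29, "`𝐈` is the multiplicative extension of the almost complex structure")] [cite: DeligneHodgeII1971, Déf. 2.1.15] -/
theorem conjG_rotG (θ : ℝ) (w : GForm E ℂ) : GForm.conjG (rotG E θ w) = rotG E θ (GForm.conjG w) := by
  rw [rotG_apply_eq_pullG, rotG_apply_eq_pullG, GForm.conjG_pullG]

omit [Nontrivial E] in
/-- **The Poincaré transpose of a REAL operator is real**: if `B_e(T x, y) = B_e(x, ᵗT y)` for all `x, y` and `T x̄ = \overline{T x}`, then `ᵗT ȳ = \overline{ᵗT y}` (`B_e` is real and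
non-degenerate). [cite: Andre1996Motifs, §1.1 (p. 11), Prop. 3.3 (proof, p. 22)] [cite: Huybrechts2005, §1.2 Remark 1.2.19 (i)] -/
theorem conjG_apply_of_isAdjointPair_poincarePairingG (e : Fin N ≃ ι) {T Tt : Module.End ℂ (GForm E ℂ)}
    (hadj : LinearMap.IsAdjointPair (poincarePairingG Φ e) (poincarePairingG Φ e) T Tt) (hT : ∀ x, GForm.conjG (T x) = T (GForm.conjG x))
    (y : GForm E ℂ) : GForm.conjG (Tt y) = Tt (GForm.conjG y) := by
  obtain ⟨-, hr⟩ := poincarePairingG_nondegenerate Φ e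
  rw [← sub_eq_zero]
  refine hr _ fun x ↦ ?_
  rw [map_sub, sub_eq_zero]
  have h1 : poincarePairingG Φ e x (GForm.conjG (Tt y)) = starRingEnd ℂ (poincarePairingG Φ e (GForm.conjG x) (Tt y)) := by
    rw [← poincarePairingG_conjG_conjG, GForm.conjG_conjG]
  rw [h1, ← hadj (GForm.conjG x) y, ← hT x, ← hadj x (GForm.conjG y)]
  conv_lhs => rw [← GForm.conjG_conjG y, poincarePairingG_conjG_conjG, Complex.conj_conj]

end Reality

/-! ## §2 `*_H` commutes with `η`-preserving pull-backs and with the Weil operator -/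

section Commute

/-- **`M^*` commutes with André's `*_H` for every `η`-preserving `M : E →L[ℝ] E`** (`*_H ∈ ℂ[L_η, ᶜΛ_η]`, p34's `andreHodgeInvolution_mem_adjoin_pair_dual`, whose commutant contains
the `η`-preserving pull-backs by the bicommutant criterion — the argument of row g50-#7 for `*_L`, `∗`). [cite: Andre1996Motifs, Prop. 1.2 (p. 11: `ℚ[L, *_H] = ℚ[L, ᶜΛ]`)]
[cite: Huybrechts2005, §1.2 Exercise 1.2.3] -/
theorem commute_pullAlgHom_andreHodgeInvolution {M : E →L[ℝ] E} (hM : ∀ u v : E, η ![M u, M v] = η ![u, v]) (d : ℕ) :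
    Commute (GForm.pullAlgHom M).toLinearMap ((hasLefschetzProperty_lefschetzG hη).andreHodgeInvolution isZGrading_countingG d) := by
  have hL : Commute (GForm.pullAlgHom M).toLinearMap (lefschetzG η) := commute_pullAlgHom_lefschetzG hM
  have hΛ : Commute (GForm.pullAlgHom M).toLinearMap ((hasLefschetzProperty_lefschetzG hη).dual isZGrading_countingG) := by
    rw [dual_lefschetzG_eq_lefschetzDualG hη]
    exact commute_pullAlgHom_lefschetzDualG hη hM
  exact ((hasLefschetzProperty_lefschetzG hη).mem_adjoin_pair_dual_iff_forall_commute' isZGrading_countingG _).1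
    ((hasLefschetzProperty_lefschetzG hη).andreHodgeInvolution_mem_adjoin_pair_dual isZGrading_countingG d) _ hL hΛ

/-- **`(e^{iθ})^*` commutes with `*_H`** for a non-degenerate `η` of type `(1,1)` (the rotation `e^{iθ}` preserves `η`); `θ = π/2`: the Weil operator `C` commutes with `*_H`.
[cite: Huybrechts2005, §1.2 Exercise 1.2.3 ("`[L, 𝐈] = [Λ, 𝐈] = 0`")] [cite: Andre1996Motifs, Prop. 1.2 (p. 11)] -/
theorem commute_rotG_andreHodgeInvolution (h11 : ∀ u v : E, η ![Complex.I • u, Complex.I • v] = η ![u, v]) (hη : ∀ v : E, v ≠ 0 → ∃ w : E, η ![v, w] ≠ 0)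
    (θ : ℝ) (d : ℕ) : Commute (rotG E θ) ((hasLefschetzProperty_lefschetzG hη).andreHodgeInvolution isZGrading_countingG d) := by
  rw [rotG_eq_pullAlgHom]
  exact commute_pullAlgHom_andreHodgeInvolution hη (twoForm_rotateCLM h11 θ) d

/-- `(e^{iθ})^*(*_H y) = *_H((e^{iθ})^* y)`. [cite: Huybrechts2005, §1.2 Exercise 1.2.3] -/
theorem rotG_andreHodgeInvolution_apply (h11 : ∀ u v : E, η ![Complex.I • u, Complex.I • v] = η ![u, v]) (hη : ∀ v : E, v ≠ 0 → ∃ w : E, η ![v, w] ≠ 0)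
    (θ : ℝ) (d : ℕ) (y : GForm E ℂ) :
    rotG E θ ((hasLefschetzProperty_lefschetzG hη).andreHodgeInvolution isZGrading_countingG d y) =
      (hasLefschetzProperty_lefschetzG hη).andreHodgeInvolution isZGrading_countingG d (rotG E θ y) :=
  LinearMap.congr_fun (commute_rotG_andreHodgeInvolution h11 hη θ d).eq y

end Commute

/-! ## §3 André's adjoint `u′ = *_H ᵗu *_H` is the `⟨ , ⟩_H`-adjoint of `u` -/

section Adjoint

/-- **THE ADJUNCTION: `⟨(*_H ᵗu *_H) x, y⟩_H = ⟨x, u y⟩_H`** for every operator `u` on `H•(X; ℂ)` which is REAL (`u x̄ = \overline{u x}`) and COMMUTES WITH THE WEIL OPERATOR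
`C = rotG E (π/2)`, `ᵗu` its Poincaré transpose (`B_e(u x, y) = B_e(x, ᵗu y)`): `⟨x, u y⟩_H = σ K_H(C u y, x̄) = σ K_H(u C y, x̄) = σ K_H(C y, *_H ᵗu *_H x̄)` (`*_H ᵗu *_H` is the
`K_H`-transpose of `u`, row g51-#5) `= σ K_H(C y, \overline{*_H ᵗu *_H x})` (`*_H`, `ᵗu` real). So André's `u ↦ *_H ᵗu *_H` is the adjunction of the Hodge metric — the
mechanism behind "définie positive" in Prop. 3.3. [cite: Andre1996Motifs, Prop. 3.3 (p. 21) and its proof (p. 22)] [cite: Kleiman1968AlgebraicCycles, §3 Thm. 3.11] -/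
theorem andreHodgeMetric_andreAdjoint_left (hη : ∀ v : E, v ≠ 0 → ∃ w : E, η ![v, w] ≠ 0) (e : Fin N ≃ ι) {T Tt : Module.End ℂ (GForm E ℂ)}
    (hadj : LinearMap.IsAdjointPair (poincarePairingG Φ e) (poincarePairingG Φ e) T Tt) (hC : Commute (rotG E (Real.pi / 2)) T)
    (hT : ∀ x, GForm.conjG (T x) = T (GForm.conjG x)) (x y : GForm E ℂ) :
    andreHodgeMetric Φ hη e
        (((hasLefschetzProperty_lefschetzG hη).andreHodgeInvolution isZGrading_countingG (finrank ℂ E) * Tt *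
          (hasLefschetzProperty_lefschetzG hη).andreHodgeInvolution isZGrading_countingG (finrank ℂ E)) x) y =
      andreHodgeMetric Φ hη e x (T y) := by
  have hTt : ∀ z, GForm.conjG (Tt z) = Tt (GForm.conjG z) := conjG_apply_of_isAdjointPair_poincarePairingG Φ e hadj hT
  have hCy : T (rotG E (Real.pi / 2) y) = rotG E (Real.pi / 2) (T y) := (LinearMap.congr_fun hC.eq y).symm
  have hK := isAdjointPair_compl₂_andreHodgeInvolution_of_isAdjointPair Φ hη e (finrank ℂ E) hadj (rotG E (Real.pi / 2) y) (GForm.conjG x)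
  rw [Module.End.mul_apply, Module.End.mul_apply] at hK
  rw [andreHodgeMetric_apply, andreHodgeMetric_apply, Module.End.mul_apply, Module.End.mul_apply, conjG_andreHodgeInvolution hη, hTt,
    conjG_andreHodgeInvolution hη, ← hK, hCy]

/-- **`⟨x, (*_H ᵗu *_H) y⟩_H = ⟨u x, y⟩_H`** (`η` a Kähler datum, `e : Fin (2g) ≃ ι`): the adjunction on the other side, by the Hermitian symmetry of `⟨ , ⟩_H` (row g52-#1).
[cite: Andre1996Motifs, Prop. 3.3 (p. 21) and its proof (p. 22)] [cite: DeligneHodgeII1971, Déf. 2.1.15] -/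
theorem andreHodgeMetric_andreAdjoint_right (h11 : ∀ u v : E, η ![Complex.I • u, Complex.I • v] = η ![u, v]) (hpos : ∀ u : E, u ≠ 0 → 0 < η ![Complex.I • u, u])
    (hη : ∀ v : E, v ≠ 0 → ∃ w : E, η ![v, w] ≠ 0) {g : ℕ} (e : Fin (2 * g) ≃ ι) {T Tt : Module.End ℂ (GForm E ℂ)}
    (hadj : LinearMap.IsAdjointPair (poincarePairingG Φ e) (poincarePairingG Φ e) T Tt) (hC : Commute (rotG E (Real.pi / 2)) T)
    (hT : ∀ x, GForm.conjG (T x) = T (GForm.conjG x)) (x y : GForm E ℂ) :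
    andreHodgeMetric Φ hη e x
        (((hasLefschetzProperty_lefschetzG hη).andreHodgeInvolution isZGrading_countingG (finrank ℂ E) * Tt *
          (hasLefschetzProperty_lefschetzG hη).andreHodgeInvolution isZGrading_countingG (finrank ℂ E)) y) =
      andreHodgeMetric Φ hη e (T x) y := by
  rw [← conj_andreHodgeMetric Φ h11 hpos hη e, andreHodgeMetric_andreAdjoint_left Φ hη e hadj hC hT, conj_andreHodgeMetric Φ h11 hpos hη e]

end Adjoint

/-! ## §4 `Tr(u ∘ *_H ᵗu *_H) > 0` for `u ≠ 0` -/

section Trace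

/-- **`Tr(u ∘ *_H ᵗu *_H) = c ≥ 0`, with `c > 0` if `u ≠ 0`**, for every REAL operator `u` on `H•(X; ℂ)` commuting with the Weil operator, `ᵗu` its Poincaré transpose (`η` a Kähler
datum, `e : Fin (2g) ≃ ι`): `*_H ᵗu *_H` is the `⟨ , ⟩_H`-adjoint of `u` (§3), so `Tr(u ∘ *_H ᵗu *_H) = Σᵢ ‖*_H ᵗu *_H bᵢ‖²_H` in an `⟨ , ⟩_H`-orthonormal basis.
[cite: Andre1996Motifs, Prop. 3.3 (p. 21)] [cite: Kleiman1968AlgebraicCycles, §3 Thm. 3.11] [cite: HornJohnson2013, §5.6 and (0.2.5)] -/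
theorem exists_nonneg_trace_mul_andreAdjoint (h11 : ∀ u v : E, η ![Complex.I • u, Complex.I • v] = η ![u, v]) (hpos : ∀ u : E, u ≠ 0 → 0 < η ![Complex.I • u, u])
    (hη : ∀ v : E, v ≠ 0 → ∃ w : E, η ![v, w] ≠ 0) {g : ℕ} (e : Fin (2 * g) ≃ ι) {T Tt : Module.End ℂ (GForm E ℂ)}
    (hadj : LinearMap.IsAdjointPair (poincarePairingG Φ e) (poincarePairingG Φ e) T Tt) (hC : Commute (rotG E (Real.pi / 2)) T)
    (hT : ∀ x, GForm.conjG (T x) = T (GForm.conjG x)) :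
    ∃ c : ℝ, 0 ≤ c ∧
      LinearMap.trace ℂ (GForm E ℂ) (T * ((hasLefschetzProperty_lefschetzG hη).andreHodgeInvolution isZGrading_countingG (finrank ℂ E) * Tt *
        (hasLefschetzProperty_lefschetzG hη).andreHodgeInvolution isZGrading_countingG (finrank ℂ E))) = c ∧ (T ≠ 0 → 0 < c) :=
  exists_nonneg_trace_mul_eq₅₅ (andreHodgeCore Φ h11 hpos hη e) fun x y ↦ by
    rw [andreHodgeCore_inner, andreHodgeCore_inner]
    exact andreHodgeMetric_andreAdjoint_left Φ hη e hadj hC hT x y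

/-- **ANDRÉ 1996 PROP. 3.3 / KLEIMAN 1968 THM. 3.11 ON A COMPLEX TORUS, UNCONDITIONALLY: `Tr(u ∘ *_H ᵗu *_H) = c > 0` for every non-zero REAL operator `u` on `H•(X; ℂ)`
commuting with the Weil operator** (`ᵗu` the Poincaré transpose; `η` a Kähler datum, `e : Fin (2g) ≃ ι`) — "`(u, v) ↦ Tr_{H(X)}(u *_H ᵗv *_H)` est […] définie positive": the
transposition `u ↦ u′ = *_H ᵗu *_H` is a POSITIVE involution. Applies to every endomorphism of the real Hodge structure `H•(X; ℝ)`, in particular to the action of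
correspondences. [cite: Andre1996Motifs, Prop. 3.3 (p. 21) and its proof (p. 22, "cf. [Kl68], 3.11")] [cite: Kleiman1968AlgebraicCycles, §3 Thm. 3.11]
[cite: Milne2002Polarizations, p. 7 ("the trace pairing `u, v ↦ Tr(u·v†)` […] is positive-definite")] -/
theorem exists_pos_trace_mul_andreAdjoint (h11 : ∀ u v : E, η ![Complex.I • u, Complex.I • v] = η ![u, v]) (hpos : ∀ u : E, u ≠ 0 → 0 < η ![Complex.I • u, u])
    (hη : ∀ v : E, v ≠ 0 → ∃ w : E, η ![v, w] ≠ 0) {g : ℕ} (e : Fin (2 * g) ≃ ι) {T Tt : Module.End ℂ (GForm E ℂ)}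
    (hadj : LinearMap.IsAdjointPair (poincarePairingG Φ e) (poincarePairingG Φ e) T Tt) (hC : Commute (rotG E (Real.pi / 2)) T)
    (hT : ∀ x, GForm.conjG (T x) = T (GForm.conjG x)) (h0 : T ≠ 0) :
    ∃ c : ℝ, 0 < c ∧
      LinearMap.trace ℂ (GForm E ℂ) (T * ((hasLefschetzProperty_lefschetzG hη).andreHodgeInvolution isZGrading_countingG (finrank ℂ E) * Tt *
        (hasLefschetzProperty_lefschetzG hη).andreHodgeInvolution isZGrading_countingG (finrank ℂ E))) = c := by
  obtain ⟨c, -, hc, hpos'⟩ := exists_nonneg_trace_mul_andreAdjoint Φ h11 hpos hη e hadj hC hT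
  exact ⟨c, hpos' h0, hc⟩

/-- **`Tr(u ∘ *_H ᵗu *_H) = 0 ↔ u = 0`** for real `u` commuting with the Weil operator (`η` a Kähler datum): the trace form is ANISOTROPIC — "définie".
[cite: Andre1996Motifs, Prop. 3.3 (p. 21)] [cite: Kleiman1968AlgebraicCycles, §3 Thm. 3.11] -/
theorem trace_mul_andreAdjoint_eq_zero_iff (h11 : ∀ u v : E, η ![Complex.I • u, Complex.I • v] = η ![u, v]) (hpos : ∀ u : E, u ≠ 0 → 0 < η ![Complex.I • u, u])
    (hη : ∀ v : E, v ≠ 0 → ∃ w : E, η ![v, w] ≠ 0) {g : ℕ} (e : Fin (2 * g) ≃ ι) {T Tt : Module.End ℂ (GForm E ℂ)}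
    (hadj : LinearMap.IsAdjointPair (poincarePairingG Φ e) (poincarePairingG Φ e) T Tt) (hC : Commute (rotG E (Real.pi / 2)) T)
    (hT : ∀ x, GForm.conjG (T x) = T (GForm.conjG x)) :
    LinearMap.trace ℂ (GForm E ℂ) (T * ((hasLefschetzProperty_lefschetzG hη).andreHodgeInvolution isZGrading_countingG (finrank ℂ E) * Tt *
        (hasLefschetzProperty_lefschetzG hη).andreHodgeInvolution isZGrading_countingG (finrank ℂ E))) = 0 ↔ T = 0 := by
  refine ⟨fun htr ↦ by_contra fun h0 ↦ ?_, fun h ↦ by rw [h, zero_mul, map_zero]⟩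
  obtain ⟨c, hc, hcx⟩ := exists_pos_trace_mul_andreAdjoint Φ h11 hpos hη e hadj hC hT h0
  rw [htr] at hcx
  exact hc.ne' (by exact_mod_cast hcx.symm)

/-- **`Tr(*_H ᵗu *_H ∘ u) = c > 0` for `u ≠ 0`** (the same number: `Tr(AB) = Tr(BA)`) — André's order `Tr(u′ ∘ u)` / Milne's `Tr(u · v†)` agree.
[cite: Andre1996Motifs, Prop. 3.3 (p. 21)] [cite: Milne2002Polarizations, p. 7] -/
theorem exists_pos_trace_andreAdjoint_mul (h11 : ∀ u v : E, η ![Complex.I • u, Complex.I • v] = η ![u, v]) (hpos : ∀ u : E, u ≠ 0 → 0 < η ![Complex.I • u, u])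
    (hη : ∀ v : E, v ≠ 0 → ∃ w : E, η ![v, w] ≠ 0) {g : ℕ} (e : Fin (2 * g) ≃ ι) {T Tt : Module.End ℂ (GForm E ℂ)}
    (hadj : LinearMap.IsAdjointPair (poincarePairingG Φ e) (poincarePairingG Φ e) T Tt) (hC : Commute (rotG E (Real.pi / 2)) T)
    (hT : ∀ x, GForm.conjG (T x) = T (GForm.conjG x)) (h0 : T ≠ 0) :
    ∃ c : ℝ, 0 < c ∧
      LinearMap.trace ℂ (GForm E ℂ) ((hasLefschetzProperty_lefschetzG hη).andreHodgeInvolution isZGrading_countingG (finrank ℂ E) * Tt *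
        (hasLefschetzProperty_lefschetzG hη).andreHodgeInvolution isZGrading_countingG (finrank ℂ E) * T) = c := by
  rw [LinearMap.trace_mul_comm]
  exact exists_pos_trace_mul_andreAdjoint Φ h11 hpos hη e hadj hC hT h0

/-- **On a polarized complex torus** (`η` a Riemann form): `Tr(u ∘ *_H ᵗu *_H) = c > 0` for every non-zero real operator `u` on `H•(X; ℂ)` commuting with the Weil operator.
[cite: Andre1996Motifs, Prop. 3.3 (p. 21)] [cite: Kleiman1968AlgebraicCycles, §3 Thm. 3.11] -/
theorem IsRiemannForm.exists_pos_trace_mul_andreAdjoint (hR : IsRiemannForm Φ η) {g : ℕ} (e : Fin (2 * g) ≃ ι) {T Tt : Module.End ℂ (GForm E ℂ)}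
    (hadj : LinearMap.IsAdjointPair (poincarePairingG Φ e) (poincarePairingG Φ e) T Tt) (hC : Commute (rotG E (Real.pi / 2)) T)
    (hT : ∀ x, GForm.conjG (T x) = T (GForm.conjG x)) (h0 : T ≠ 0) :
    ∃ c : ℝ, 0 < c ∧
      LinearMap.trace ℂ (GForm E ℂ) (T * ((hasLefschetzProperty_lefschetzG (hR.exists_apply_ne_zero Φ)).andreHodgeInvolution isZGrading_countingG (finrank ℂ E) * Tt *
        (hasLefschetzProperty_lefschetzG (hR.exists_apply_ne_zero Φ)).andreHodgeInvolution isZGrading_countingG (finrank ℂ E))) = c :=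
  ComplexTorus.exists_pos_trace_mul_andreAdjoint Φ hR.1 hR.2.2 (hR.exists_apply_ne_zero Φ) e hadj hC hT h0

end Trace

end ComplexTorus

end Literature.Geometry.Kaehler
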